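import Summits.HubbardSuperconductivity.HubbardSuperconductivity.Theorems.WidthHaldaneTubeEtaPairing
import Literature.MathematicalPhysics.QuantumLattice.SectorPartitionFloor

/-!
# The helicity descent: the twisted sector free energy is at most the twisted sector energy

Support file for crux `WidthUniformThermodynamics` (stmt-HubbardSuperconductivity-16312; routes
`WidthHaldane`, `SeamInduction`). The crux idea
`Cruxes/WidthUniformThermodynamics/Ideas/euclidean-helicity-descent.md` (2026-08-17 round) replaces
the sector MINIMUM `E(θ) = tubeEnergy` by the canonical sector FREE ENERGY
`F_β(θ) = -β⁻¹ log Z_β(θ)`, `Z_β(θ) = tr (P_{(N, S^z=0)} e^{-β(H₀ + Tw_θ)})`, at a mesoscopic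
`β = C·L`, through the one-line DESCENT (its first lemma `HelicityDescent`, "provable now"):

  `E(θ₀) - E(0) ≥ [F_β(θ₀) - F_β(0)] - β⁻¹ log (Z_β(0) e^{βE(0)})`,

i.e. `F_β(θ₀) ≤ E(θ₀)` (one eigenvalue bounds the twisted trace from below) together with the
identity `F_β(0) + β⁻¹ log (Z_β(0) e^{βE(0)}) = E(0)`. This file PROVES it, def-free, in the tree's
vocabulary (`Z_β(θ)` written out as `re tr (P_K e^{-βH})` with `P_K = projMatrix` of the transported
sector and `e^{-βH} = Matrix.gibbsWeight`, exactly as in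
`Literature/…/FinDimSpectrumSectorGibbsLimit`; a line naming `tubeSectorZ`/`tubeSectorF` gets these by
`rfl`), for the sectors `(2n, S^z = 0)`, `n ≤ LM` (the odd-`N` sectors with `S^z = 0` are empty):

* `tubeH_mulVec_mem_szSector` — the twisted tube preserves the joint sectors (as a submodule map);
* `szSector_inf_eigenspace_ne_bot` — its sector ground eigenspace is non-trivial;
* **`exp_neg_mul_tubeEnergy_le_re_trace_proj_gibbsWeight`** — `e^{-βE(θ, 2n)} ≤ Z_β(θ)` for every real
  `β` (`Literature/…/SectorPartitionFloor`), `re_trace_proj_gibbsWeight_tubeH_pos` — `0 < Z_β(θ)`;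
* **`neg_log_sectorPartition_div_le_tubeEnergy`** — `F_β(θ) ≤ E(θ, 2n)` for `β > 0`;
* **`helicity_descent`** / `helicityDescent` (closed form, the registered sub-goal) — the descent
  inequality displayed above, for every `β > 0`, every `θ₀` and every labelled tube.

A handle for a line of the crux built on the helicity card (its ★ stubs `HelicityFloorAt`,
`EntropyBudgetAt` are untouched), not progress on the open core. References: O. Bratteli,
D. W. Robinson, *Operator Algebras and Quantum Statistical Mechanics II* §5.3.1; E. L. Pollock,
D. M. Ceperley, PRB 36 (1987) 8343 (helicity modulus from twisted partition functions).
-/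

noncomputable section

namespace Summit.HubbardSuperconductivity.HubbardSuperconductivity.Theorems.WidthHaldane

set_option linter.dupNamespace false -- summit = problem name (single-conjunct summit), D-0017

open scoped BigOperators Classical Matrix ComplexConjugate Matrix.Norms.L2Operator
open Matrix Literature.MathematicalPhysics.QuantumLattice

section HelicityDescent

variable (L M : ℕ) [NeZero L] [NeZero M] (Λ : Type) [LinearOrder Λ] [Fintype Λ]
  (e : Λ ≃ ZMod L × ZMod M)

/-- The twisted tube maps every joint sector `(2n, S^z = 0)` into itself (it is block diagonal in
`(N↑, N↓)`, `preservesSectors_tubeH`). [folklore] -/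
theorem tubeH_mulVec_mem_szSector (U θ : ℝ) (n : ℕ) {v : Fock (Orb Λ)}
    (hv : v ∈ szSector (2 * n) 0) :
    (tubeH0 L M Λ e U + tubeTwist L M Λ e θ) *ᵥ v ∈ szSector (2 * n) 0 :=
  (mem_szSector_two_mul_zero_iff n _).2
    ((preservesSectors_tubeH L M Λ e U θ).isInSector_mulVec ((mem_szSector_two_mul_zero_iff n v).1 hv))

/-- The sector ground eigenspace `(2n, S^z = 0) ⊓ ker (H - E(θ, 2n))` of the twisted tube is
non-trivial for `n ≤ LM` (`exists_isGroundStateInSector_tubeH`). [folklore] -/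
theorem szSector_inf_eigenspace_ne_bot (U θ : ℝ) {n : ℕ} (hn : n ≤ L * M) :
    szSector (Λ := Λ) (2 * n) 0 ⊓ Module.End.eigenspace
        (Matrix.toLin' (tubeH0 L M Λ e U + tubeTwist L M Λ e θ))
        ((((tubeH0 L M Λ e U + tubeTwist L M Λ e θ).minEnergyOn (szSector (2 * n) 0) : ℝ) : ℂ)) ≠ ⊥ := by
  obtain ⟨ψ, hψK, hψ0, hHψ⟩ := exists_isGroundStateInSector_tubeH L M Λ e U θ hn
  rw [Submodule.ne_bot_iff]
  refine ⟨ψ, Submodule.mem_inf.2 ⟨hψK, ?_⟩, hψ0⟩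
  rw [Module.End.mem_eigenspace_iff, Matrix.toLin'_apply]
  exact hHψ

/-- **`e^{-βE(θ, 2n)} ≤ Z_β(θ)`**: the canonical partition function of the sector `(2n, S^z = 0)` of
the twisted tube, `Z_β(θ) = re tr (P_{(2n,0)} e^{-β(H₀ + Tw_θ)})`, is at least the Boltzmann weight
of the twisted sector energy, for every real `β` and `n ≤ LM`. [folklore] -/
theorem exp_neg_mul_tubeEnergy_le_re_trace_proj_gibbsWeight (U θ β : ℝ) {n : ℕ} (hn : n ≤ L * M) :
    Real.exp (-(β * tubeEnergy L M Λ e U θ (2 * n))) ≤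
      ((projMatrix ((szSector (Λ := Λ) (2 * n) 0).map
          ((WithLp.linearEquiv 2 ℂ (Finset (Orb Λ) → ℂ)).symm :
            (Finset (Orb Λ) → ℂ) →ₗ[ℂ] EuclideanSpace ℂ (Finset (Orb Λ)))) *
        gibbsWeight β (tubeH0 L M Λ e U + tubeTwist L M Λ e θ)).trace).re := by
  rw [tubeEnergy_eq]
  exact exp_neg_mul_minEnergyOn_le_re_trace_proj_gibbsWeight (isHermitian_tubeH L M Λ e U θ) _
    (fun v hv => tubeH_mulVec_mem_szSector L M Λ e U θ n hv)
    (szSector_inf_eigenspace_ne_bot L M Λ e U θ hn) β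

/-- **`0 < Z_β(θ)`** on the sectors `(2n, S^z = 0)`, `n ≤ LM`. [folklore] -/
theorem re_trace_proj_gibbsWeight_tubeH_pos (U θ β : ℝ) {n : ℕ} (hn : n ≤ L * M) :
    0 < ((projMatrix ((szSector (Λ := Λ) (2 * n) 0).map
          ((WithLp.linearEquiv 2 ℂ (Finset (Orb Λ) → ℂ)).symm :
            (Finset (Orb Λ) → ℂ) →ₗ[ℂ] EuclideanSpace ℂ (Finset (Orb Λ)))) *
        gibbsWeight β (tubeH0 L M Λ e U + tubeTwist L M Λ e θ)).trace).re :=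
  lt_of_lt_of_le (Real.exp_pos _) (exp_neg_mul_tubeEnergy_le_re_trace_proj_gibbsWeight L M Λ e U θ β hn)

/-- **The twisted sector free energy is at most the twisted sector energy**:
`F_β(θ) = -β⁻¹ log Z_β(θ) ≤ E_{L,M}(U; θ, 2n)` for `β > 0`, `n ≤ LM`. [folklore] -/
theorem neg_log_sectorPartition_div_le_tubeEnergy (U θ : ℝ) {β : ℝ} (hβ : 0 < β) {n : ℕ}
    (hn : n ≤ L * M) :
    -Real.log ((projMatrix ((szSector (Λ := Λ) (2 * n) 0).map
          ((WithLp.linearEquiv 2 ℂ (Finset (Orb Λ) → ℂ)).symm :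
            (Finset (Orb Λ) → ℂ) →ₗ[ℂ] EuclideanSpace ℂ (Finset (Orb Λ)))) *
        gibbsWeight β (tubeH0 L M Λ e U + tubeTwist L M Λ e θ)).trace).re / β ≤
      tubeEnergy L M Λ e U θ (2 * n) := by
  rw [tubeEnergy_eq]
  exact neg_log_re_trace_proj_gibbsWeight_div_le_minEnergyOn (isHermitian_tubeH L M Λ e U θ) _
    (fun v hv => tubeH_mulVec_mem_szSector L M Λ e U θ n hv)
    (szSector_inf_eigenspace_ne_bot L M Λ e U θ hn) hβ

/-- **THE HELICITY DESCENT** (card `euclidean-helicity-descent`, `HelicityDescent`): for `β > 0`,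
every flux `θ₀` and every sector `(2n, S^z = 0)`, `n ≤ LM`,
`E(θ₀) - E(0) ≥ [F_β(θ₀) - F_β(0)] - β⁻¹ log (Z_β(0) e^{βE(0)})` with
`Z_β(θ) = re tr (P_{(2n,0)} e^{-β(H₀+Tw_θ)})`, `F_β(θ) = -β⁻¹ log Z_β(θ)`: the `T = 0` flux cost is the
helicity modulus at temperature `1/β` minus the entropy slack of the untwisted tube (the second
bracket equals `E(0) - F_β(0) ≥ 0`). Proof: `F_β(θ₀) ≤ E(θ₀)` and `Z_β(0) > 0`. [folklore] -/
theorem helicity_descent (U θ₀ : ℝ) {β : ℝ} (hβ : 0 < β) {n : ℕ} (hn : n ≤ L * M) :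
    (-Real.log ((projMatrix ((szSector (Λ := Λ) (2 * n) 0).map
          ((WithLp.linearEquiv 2 ℂ (Finset (Orb Λ) → ℂ)).symm :
            (Finset (Orb Λ) → ℂ) →ₗ[ℂ] EuclideanSpace ℂ (Finset (Orb Λ)))) *
        gibbsWeight β (tubeH0 L M Λ e U + tubeTwist L M Λ e θ₀)).trace).re / β -
      -Real.log ((projMatrix ((szSector (Λ := Λ) (2 * n) 0).map
          ((WithLp.linearEquiv 2 ℂ (Finset (Orb Λ) → ℂ)).symm :
            (Finset (Orb Λ) → ℂ) →ₗ[ℂ] EuclideanSpace ℂ (Finset (Orb Λ)))) *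
        gibbsWeight β (tubeH0 L M Λ e U + tubeTwist L M Λ e 0)).trace).re / β) -
      Real.log (((projMatrix ((szSector (Λ := Λ) (2 * n) 0).map
          ((WithLp.linearEquiv 2 ℂ (Finset (Orb Λ) → ℂ)).symm :
            (Finset (Orb Λ) → ℂ) →ₗ[ℂ] EuclideanSpace ℂ (Finset (Orb Λ)))) *
        gibbsWeight β (tubeH0 L M Λ e U + tubeTwist L M Λ e 0)).trace).re *
          Real.exp (β * tubeEnergy L M Λ e U 0 (2 * n))) / β ≤
      tubeEnergy L M Λ e U θ₀ (2 * n) - tubeEnergy L M Λ e U 0 (2 * n) := by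
  set Z₀ := ((projMatrix ((szSector (Λ := Λ) (2 * n) 0).map
          ((WithLp.linearEquiv 2 ℂ (Finset (Orb Λ) → ℂ)).symm :
            (Finset (Orb Λ) → ℂ) →ₗ[ℂ] EuclideanSpace ℂ (Finset (Orb Λ)))) *
        gibbsWeight β (tubeH0 L M Λ e U + tubeTwist L M Λ e 0)).trace).re with hZ₀
  have hF := neg_log_sectorPartition_div_le_tubeEnergy L M Λ e U θ₀ hβ hn
  have hZ₀pos : 0 < Z₀ := re_trace_proj_gibbsWeight_tubeH_pos L M Λ e U 0 β hn
  have hlog : Real.log (Z₀ * Real.exp (β * tubeEnergy L M Λ e U 0 (2 * n))) =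
      Real.log Z₀ + β * tubeEnergy L M Λ e U 0 (2 * n) := by
    rw [Real.log_mul hZ₀pos.ne' (Real.exp_pos _).ne', Real.log_exp]
  rw [hlog]
  have hsplit : (Real.log Z₀ + β * tubeEnergy L M Λ e U 0 (2 * n)) / β =
      Real.log Z₀ / β + tubeEnergy L M Λ e U 0 (2 * n) := by
    rw [add_div, mul_div_cancel_left₀ _ hβ.ne']
  rw [hsplit, neg_div, neg_div]
  rw [neg_div] at hF
  linarith

end HelicityDescent

/-- **THE HELICITY DESCENT, closed form** (the registered sub-goal `helicityDescent` of crux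
stmt-HubbardSuperconductivity-16312; all binders universally quantified): for every labelled tube,
every `U`, `θ₀`, every `β > 0` and every `n ≤ LM`,
`[F_β(θ₀) - F_β(0)] - β⁻¹ log (Z_β(0) e^{βE(0, 2n)}) ≤ E(θ₀, 2n) - E(0, 2n)`,
`Z_β(θ) = re tr (P_{(2n, S^z=0)} e^{-β(H₀ + Tw_θ)})`, `F_β = -β⁻¹ log Z_β`. [folklore] -/
theorem helicityDescent : ∀ (L M : ℕ) [NeZero L] [NeZero M] (Λ : Type) [LinearOrder Λ] [Fintype Λ] (e : Λ ≃ ZMod L × ZMod M) (U θ₀ β : ℝ), 0 < β → ∀ n : ℕ, n ≤ L * M → (-Real.log ((projMatrix ((szSector (Λ := Λ) (2 * n) 0).map ((WithLp.linearEquiv 2 ℂ (Finset (Orb Λ) → ℂ)).symm : (Finset (Orb Λ) → ℂ) →ₗ[ℂ] EuclideanSpace ℂ (Finset (Orb Λ)))) * gibbsWeight β (tubeH0 L M Λ e U + tubeTwist L M Λ e θ₀)).trace).re / β - -Real.log ((projMatrix ((szSector (Λ := Λ) (2 * n) 0).map ((WithLp.linearEquiv 2 ℂ (Finset (Orb Λ)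 → ℂ)).symm : (Finset (Orb Λ) → ℂ) →ₗ[ℂ] EuclideanSpace ℂ (Finset (Orb Λ)))) * gibbsWeight β (tubeH0 L M Λ e U + tubeTwist L M Λ e 0)).trace).re / β) - Real.log (((projMatrix ((szSector (Λ := Λ) (2 * n) 0).map ((WithLp.linearEquiv 2 ℂ (Finset (Orb Λ) → ℂ)).symm : (Finset (Orb Λ) → ℂ) →ₗ[ℂ] EuclideanSpace ℂ (Finset (Orb Λ)))) * gibbsWeight β (tubeH0 L M Λ e U + tubeTwist L M Λ e 0)).trace).re * Real.exp (β * tubeEnergy L M Λ e U 0 (2 * n))) / β ≤ tubeEnergy L M Λ e U θ₀ (2 * n) - tubeEnergy L M Λ e U 0 (2 * n) :=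
  fun L M _ _ Λ _ _ e U θ₀ _β hβ _n hn => helicity_descent L M Λ e U θ₀ hβ hn

end Summit.HubbardSuperconductivity.HubbardSuperconductivity.Theorems.WidthHaldane

end
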